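import Mathlib.Analysis.InnerProductSpace.PiL2
import Mathlib.MeasureTheory.Function.LpSeminorm.CompareExp
import Literature.Analysis.FluidPDE.SuitableWeakPressure
import HarnessLib

/-!
# Weak spatial gradients tested against compactly supported weights (tools)

Trunk T-FLUID (`Literature/Analysis/FluidPDE`), family NS; proofs layer serving the lower
semicontinuity of the dissipation `E(Q') = r⁻¹ ∫_{Q'} |∇u|²` under the convergences of
Albritton–Barker 2019, Lemma 2.2 (`LocalTypeILscGradient.lean`). No new definitions.

For a field `f` with weak spatial gradient `G` on an open space–time region `Ω`
(`Literature.Analysis.FluidPDE.HasWeakSpatialGradientOn`, CKN 1982, (2.1)) we record: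

* `setIntegral_mul_inner_weakGradient_eq`: the defining identity in product-integral form,
  `∫_Ω φ ⟪G a, c⟫ = -∫ (∂_a φ) ⟪f, c⟫` for scalar test functions `φ` on `Ω`;
* `isSpaceTimeTestOn_euclidean_coord`: the coordinates of an `ℝ^K`-valued test field are
  scalar test functions;
* `norm_sq_coeffVec`, `inner_coeffVec_eq_sum`: the matrix coefficients `⟪L bᵢ, bⱼ⟫` of an
  operator `L` in an orthonormal basis `b`, packaged as a vector of `ℝ^{ι × ι}`
  (`EuclideanSpace ℝ (ι × ι)`), have squared norm `Σᵢ ‖L bᵢ‖²` (the Frobenius norm);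
* `setIntegral_inner_coeffVec_eq`: the pairing of the coefficient field of `G` with a vector
  test field `Ψ` is `∫_Ω ⟪coeff G, Ψ⟫ = -Σᵢⱼ ∫ ∂_{bᵢ} Ψᵢⱼ ⟪f, bⱼ⟫` — it involves `f` only;
* `tendsto_integral_mul_inner_of_tendsto_eLpNorm`: if `v_k → u` in `L³(Q₀)` and `θ` is a
  continuous weight compactly supported inside `Ω ⊆ Q₀`, then `∫ θ ⟪v_k, c⟫ → ∫ θ ⟪u, c⟫`.

Together: `∇v_k → ∇u` in the sense of distributions whenever `v_k → u` in `L³_loc`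
(Evans, *PDE*, §5.2.1; the standard compatibility of weak derivatives with `L¹_loc` limits).

## References

* L. C. Evans, *Partial Differential Equations*, 2nd ed. (2010), §5.2.1.
* L. Caffarelli, R. Kohn, L. Nirenberg, *Partial regularity of suitable weak solutions of the
  Navier–Stokes equations*, Comm. Pure Appl. Math. 35 (1982), (2.1).
-/

noncomputable section

open MeasureTheory Set Function Filter Topology TopologicalSpace Metric
open scoped NNReal ENNReal InnerProductSpace RealInnerProductSpace

namespace Literature.Analysis.FluidPDE

variable {E : Type*} [NormedAddCommGroup E] [InnerProductSpace ℝ E] [FiniteDimensional ℝ E]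
  [MeasurableSpace E] [BorelSpace E]

/-! ### The weak-gradient identity in product-integral form -/

section Identity

variable {Ω : Opens (ℝ × E)} {f : ℝ → E → E} {G : ℝ → E → E →L[ℝ] E}

/-- The matrix coefficient `(t, x) ↦ ⟪G(t, x) a, c⟫` of a locally integrable operator field is
locally integrable (a continuous linear functional of `G`). [folklore] -/
theorem locallyIntegrableOn_inner_apply {S : Set (ℝ × E)}
    (hG : LocallyIntegrableOn (uncurry G) S volume) (a c : E) :
    LocallyIntegrableOn (fun w : ℝ × E => ⟪G w.1 w.2 a, c⟫) S volume := by
  set ℓ : (E →L[ℝ] E) →L[ℝ] ℝ := (innerSL ℝ c).comp (ContinuousLinearMap.apply ℝ E a) with hℓ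
  have e : (fun w : ℝ × E => ⟪G w.1 w.2 a, c⟫) = fun w => ℓ (uncurry G w) := by
    funext w
    simp only [hℓ, ContinuousLinearMap.comp_apply, ContinuousLinearMap.apply_apply,
      innerSL_apply_apply, real_inner_comm]
    rfl
  rw [e]
  intro x hx
  obtain ⟨U, hU, hGU⟩ := hG x hx
  exact ⟨U, hU, ℓ.integrable_comp hGU⟩

/-- **The weak-gradient identity in product-integral form.** If `G` is a weak spatial gradient
of `f` on `Ω` and `φ ∈ C_c^∞(Ω)`, then `∫_Ω φ ⟪G a, c⟫ = -∫ (∂_a φ) ⟪f, c⟫` (the defining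
iterated-integral identity of `HasWeakSpatialGradientOn`, both integrands being integrable on
`ℝ × E` as products of a locally integrable function with a continuous weight supported in the
compact `tsupport φ ⊆ Ω`). [cite: CaffarelliKohnNirenberg1982, (2.1)] -/
theorem setIntegral_mul_inner_weakGradient_eq (hG : HasWeakSpatialGradientOn Ω f G)
    {φ : ℝ → E → ℝ} (hφ : IsSpaceTimeTestOn Ω φ) (a c : E) :
    ∫ w in (Ω : Set (ℝ × E)), φ w.1 w.2 * ⟪G w.1 w.2 a, c⟫ =
      -∫ w : ℝ × E, fderiv ℝ (φ w.1) w.2 a * ⟪f w.1 w.2, c⟫ := by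
  have hK : IsCompact (tsupport (uncurry φ)) := hφ.hasCompactSupport
  have hKΩ : tsupport (uncurry φ) ⊆ (Ω : Set (ℝ × E)) := hφ.tsupport_subset
  have h0 : ∀ w ∉ tsupport (uncurry φ), uncurry φ w = 0 := fun w hw =>
    image_eq_zero_of_notMem_tsupport hw
  have hint1 : Integrable (fun w : ℝ × E => ⟪G w.1 w.2 a, c⟫ * uncurry φ w) volume :=
    integrable_mul_of_locallyIntegrableOn
      (locallyIntegrableOn_inner_apply hG.locallyIntegrableOn_grad a c)
      hφ.contDiff.continuous hK hKΩ h0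
  have hdφ : IsSpaceTimeTestOn ⊤ (fun t x => fderiv ℝ (φ t) x a) :=
    (hφ.mono le_top).fderiv_apply_top a
  have hd0 : ∀ w ∉ tsupport (uncurry φ), fderiv ℝ (φ w.1) w.2 a • c = 0 := by
    rintro ⟨t, x⟩ hw
    simp [IsSpaceTimeTestOn.fderiv_slice_eq_zero_of_notMem hw]
  have hint2 : Integrable (fun w : ℝ × E => ⟪f w.1 w.2, fderiv ℝ (φ w.1) w.2 a • c⟫) volume :=
    integrable_inner_of_locallyIntegrableOn hG.locallyIntegrableOn
      (w := fun w : ℝ × E => fderiv ℝ (φ w.1) w.2 a • c)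
      (hdφ.contDiff.continuous.smul continuous_const) hK hKΩ hd0
  have hzero : ∀ w ∉ (Ω : Set (ℝ × E)), φ w.1 w.2 * ⟪G w.1 w.2 a, c⟫ = 0 := fun w hw => by
    rw [show φ w.1 w.2 = uncurry φ w from rfl, h0 w fun h => hw (hKΩ h), zero_mul]
  rw [setIntegral_eq_integral_of_forall_compl_eq_zero hzero]
  have e1 : ∫ w : ℝ × E, φ w.1 w.2 * ⟪G w.1 w.2 a, c⟫ = ∫ t, ∫ x, φ t x * ⟪G t x a, c⟫ := by
    have h : Integrable (fun w : ℝ × E => φ w.1 w.2 * ⟪G w.1 w.2 a, c⟫)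
        ((volume : Measure ℝ).prod (volume : Measure E)) := by
      rw [← Measure.volume_eq_prod]
      exact hint1.congr (ae_of_all _ fun w => mul_comm _ _)
    rw [Measure.volume_eq_prod, integral_prod _ h]
  have e2 : ∫ w : ℝ × E, fderiv ℝ (φ w.1) w.2 a * ⟪f w.1 w.2, c⟫ =
      ∫ t, ∫ x, fderiv ℝ (φ t) x a * ⟪f t x, c⟫ := by
    have h : Integrable (fun w : ℝ × E => fderiv ℝ (φ w.1) w.2 a * ⟪f w.1 w.2, c⟫)
        ((volume : Measure ℝ).prod (volume : Measure E)) := by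
      rw [← Measure.volume_eq_prod]
      exact hint2.congr (ae_of_all _ fun w => by simp only [real_inner_smul_right])
    rw [Measure.volume_eq_prod, integral_prod _ h]
  rw [e1, e2, hG.integral_fderiv_mul_inner_eq φ hφ a c, neg_neg]

omit [InnerProductSpace ℝ E] [FiniteDimensional ℝ E] [MeasurableSpace E] [BorelSpace E] in
/-- The coordinates of an `ℝ^K`-valued test field on `Ω` are scalar space–time test functions
on `Ω` (the coordinate projections are continuous linear and vanish at `0`). [folklore] -/
theorem isSpaceTimeTestOn_euclidean_coord [NormedSpace ℝ E] {K : Type*} [Fintype K]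
    {Ψ : ℝ × E → EuclideanSpace ℝ K} (hΨ : FunctionSpaces.IsTestFunctionOn Ω Ψ) (k : K) :
    IsSpaceTimeTestOn Ω (fun t x => Ψ (t, x) k) where
  contDiff := (EuclideanSpace.proj (𝕜 := ℝ) k).contDiff.comp hΨ.contDiff
  hasCompactSupport :=
    hΨ.hasCompactSupport.comp_left (g := fun y : EuclideanSpace ℝ K => y k) rfl
  tsupport_subset :=
    (tsupport_comp_subset (g := fun y : EuclideanSpace ℝ K => y k) rfl Ψ).trans hΨ.tsupport_subset

omit [InnerProductSpace ℝ E] [FiniteDimensional ℝ E] [MeasurableSpace E] [BorelSpace E] in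
/-- A function vanishing off a closed set has topological support inside it. [folklore] -/
theorem tsupport_subset_of_isClosed {Y : Type*} [Zero Y] {g : ℝ × E → Y} {K : Set (ℝ × E)}
    (hK : IsClosed K) (h : ∀ x ∉ K, g x = 0) : tsupport g ⊆ K :=
  closure_minimal (fun x hx => by_contra fun hxK => hx (h x hxK)) hK

omit [FiniteDimensional ℝ E] [MeasurableSpace E] [BorelSpace E] in
/-- The weights `(t, x) ↦ ∂_a Ψₖ(t, ·)(x)` built from the coordinates of a vector test field
`Ψ ∈ C_c^∞(Ω; ℝ^K)` are continuous, compactly supported, and supported inside `Ω`. [folklore] -/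
theorem fderiv_coord_weight {K : Type*} [Fintype K]
    {Ψ : ℝ × E → EuclideanSpace ℝ K} (hΨ : FunctionSpaces.IsTestFunctionOn Ω Ψ) (k : K) (a : E) :
    Continuous (fun w : ℝ × E => fderiv ℝ (fun x => Ψ (w.1, x) k) w.2 a) ∧
      HasCompactSupport (fun w : ℝ × E => fderiv ℝ (fun x => Ψ (w.1, x) k) w.2 a) ∧
      tsupport (fun w : ℝ × E => fderiv ℝ (fun x => Ψ (w.1, x) k) w.2 a) ⊆ (Ω : Set (ℝ × E)) := by
  have hc := isSpaceTimeTestOn_euclidean_coord hΨ k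
  have hθ : IsSpaceTimeTestOn ⊤ (fun t x => fderiv ℝ (fun x => Ψ (t, x) k) x a) :=
    (hc.mono le_top).fderiv_apply_top a
  have h0 : ∀ w ∉ tsupport (uncurry fun t x => Ψ (t, x) k),
      fderiv ℝ (fun x => Ψ (w.1, x) k) w.2 a = 0 := by
    rintro ⟨t, x⟩ hw
    simp [IsSpaceTimeTestOn.fderiv_slice_eq_zero_of_notMem hw]
  have hsub := tsupport_subset_of_isClosed (isClosed_tsupport _) h0
  exact ⟨hθ.contDiff.continuous, HasCompactSupport.intro hc.hasCompactSupport h0,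
    hsub.trans hc.tsupport_subset⟩

end Identity

/-! ### Matrix coefficients as a Euclidean vector -/

section Coeff

variable {ι : Type*} [Fintype ι]

omit [FiniteDimensional ℝ E] [MeasurableSpace E] [BorelSpace E] in
/-- The vector of matrix coefficients `(⟪L bᵢ, bⱼ⟫)ᵢⱼ ∈ ℝ^{ι × ι}` of an operator `L` in an
orthonormal basis `b` has squared Euclidean norm `Σᵢ ‖L bᵢ‖²` (Parseval in `j`).
[folklore] -/
theorem norm_sq_coeffVec (b : OrthonormalBasis ι ℝ E) (L : E →L[ℝ] E) :
    ‖(WithLp.toLp 2 (fun ij : ι × ι => ⟪L (b ij.1), b ij.2⟫) : EuclideanSpace ℝ (ι × ι))‖ ^ 2 =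
      ∑ i, ‖L (b i)‖ ^ 2 := by
  rw [EuclideanSpace.norm_sq_eq, Fintype.sum_prod_type]
  refine Finset.sum_congr rfl fun i _ => ?_
  simp only [Real.norm_eq_abs, sq_abs]
  exact b.sum_sq_inner_left (L (b i))

omit [FiniteDimensional ℝ E] [MeasurableSpace E] [BorelSpace E] in
/-- The Euclidean inner product of the coefficient vector with `y ∈ ℝ^{ι × ι}` is the
coordinate sum `Σᵢⱼ ⟪L bᵢ, bⱼ⟫ yᵢⱼ`. [folklore] -/
theorem inner_coeffVec_eq_sum (b : OrthonormalBasis ι ℝ E) (L : E →L[ℝ] E)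
    (y : EuclideanSpace ℝ (ι × ι)) :
    ⟪(WithLp.toLp 2 (fun ij : ι × ι => ⟪L (b ij.1), b ij.2⟫) : EuclideanSpace ℝ (ι × ι)), y⟫ =
      ∑ ij, ⟪L (b ij.1), b ij.2⟫ * y ij := by
  simp [PiLp.inner_apply, mul_comm]

omit [MeasurableSpace E] [BorelSpace E] in
/-- For the standard basis, `Σᵢ ‖L bᵢ‖²` is the accepted `frobeniusNormSq L`. [folklore] -/
theorem norm_sq_coeffVec_std (L : E →L[ℝ] E) :
    ‖(WithLp.toLp 2 (fun ij : Fin (Module.finrank ℝ E) × Fin (Module.finrank ℝ E) =>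
        ⟪L (stdOrthonormalBasis ℝ E ij.1), stdOrthonormalBasis ℝ E ij.2⟫) :
        EuclideanSpace ℝ (Fin (Module.finrank ℝ E) × Fin (Module.finrank ℝ E)))‖ ^ 2 =
      frobeniusNormSq L := by
  rw [norm_sq_coeffVec, frobeniusNormSq]

variable {Ω : Opens (ℝ × E)} {f : ℝ → E → E} {G : ℝ → E → E →L[ℝ] E}

/-- **Pairing the coefficient field of a weak gradient with a vector test field.** For `G` a
weak spatial gradient of `f` on `Ω`, an orthonormal basis `b`, and a test field
`Ψ ∈ C_c^∞(Ω; ℝ^{ι × ι})`: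
`∫_Ω ⟪coeff_b G, Ψ⟫ = -Σᵢⱼ ∫ (∂_{bᵢ} Ψᵢⱼ) ⟪f, bⱼ⟫` (coordinatewise
`setIntegral_mul_inner_weakGradient_eq`). The right-hand side involves `f` only.
[cite: CaffarelliKohnNirenberg1982, (2.1)] -/
theorem setIntegral_inner_coeffVec_eq (hG : HasWeakSpatialGradientOn Ω f G)
    (b : OrthonormalBasis ι ℝ E) {Ψ : ℝ × E → EuclideanSpace ℝ (ι × ι)}
    (hΨ : FunctionSpaces.IsTestFunctionOn Ω Ψ) :
    ∫ w in (Ω : Set (ℝ × E)),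
        ⟪(WithLp.toLp 2 (fun ij : ι × ι => ⟪G w.1 w.2 (b ij.1), b ij.2⟫) :
          EuclideanSpace ℝ (ι × ι)), Ψ w⟫ =
      -∑ ij : ι × ι, ∫ w : ℝ × E,
        fderiv ℝ (fun x => Ψ (w.1, x) ij) w.2 (b ij.1) * ⟪f w.1 w.2, b ij.2⟫ := by
  simp_rw [inner_coeffVec_eq_sum]
  have hcoord := fun ij : ι × ι => isSpaceTimeTestOn_euclidean_coord hΨ ij
  have hint : ∀ ij : ι × ι, Integrable (fun w : ℝ × E => ⟪G w.1 w.2 (b ij.1), b ij.2⟫ * Ψ w ij)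
      (volume.restrict (Ω : Set (ℝ × E))) := by
    intro ij
    have h := integrable_mul_of_locallyIntegrableOn
      (locallyIntegrableOn_inner_apply hG.locallyIntegrableOn_grad (b ij.1) (b ij.2))
      (hcoord ij).contDiff.continuous (hcoord ij).hasCompactSupport.isCompact
      (hcoord ij).tsupport_subset
      (fun w hw => image_eq_zero_of_notMem_tsupport hw)
    exact h.integrableOn
  rw [integral_finsetSum _ fun ij _ => hint ij, ← Finset.sum_neg_distrib]
  refine Finset.sum_congr rfl fun ij _ => ?_
  rw [← setIntegral_mul_inner_weakGradient_eq hG (hcoord ij) (b ij.1) (b ij.2)]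
  exact integral_congr_ae (ae_of_all _ fun w => mul_comm _ _)

end Coeff

/-! ### Strong `L³` limits pass through the pairing -/

section Limit

variable {Ω : Opens (ℝ × E)} {Q₀ : Set (ℝ × E)} {v : ℕ → ℝ → E → E} {u : ℝ → E → E}

/-- **Strong `L³` limits pass through pairings with compactly supported weights.** If `v_k`,
`u` are locally integrable on the open `Ω ⊆ Q₀`, `v_k → u` in `L³(Q₀)`, `θ` is a continuous
weight with compact support inside `Ω`, and `c ∈ E`, then `∫ θ ⟪v_k, c⟫ → ∫ θ ⟪u, c⟫`:
`|∫ θ ⟪v_k - u, c⟫| ≤ sup |θ| |c| vol(supp θ)^{2/3} ‖v_k - u‖_{L³}`. [folklore] -/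
theorem tendsto_integral_mul_inner_of_tendsto_eLpNorm (hΩ : (Ω : Set (ℝ × E)) ⊆ Q₀)
    (hv : ∀ k, LocallyIntegrableOn (uncurry (v k)) (Ω : Set (ℝ × E)) volume)
    (hu : LocallyIntegrableOn (uncurry u) (Ω : Set (ℝ × E)) volume)
    (hconv : Tendsto (fun k => eLpNorm (uncurry (v k) - uncurry u) 3 (volume.restrict Q₀))
      atTop (𝓝 0))
    {θ : ℝ × E → ℝ} (hθ : Continuous θ) (hθc : HasCompactSupport θ)
    (hθΩ : tsupport θ ⊆ (Ω : Set (ℝ × E))) (c : E) :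
    Tendsto (fun k => ∫ w, θ w * ⟪v k w.1 w.2, c⟫) atTop (𝓝 (∫ w, θ w * ⟪u w.1 w.2, c⟫)) := by
  set K := tsupport θ with hKdef
  have hK : IsCompact K := hθc
  have hKm : MeasurableSet K := (isClosed_tsupport θ).measurableSet
  have hθ0 : ∀ w ∉ K, θ w = 0 := fun w hw => image_eq_zero_of_notMem_tsupport hw
  have hθc0 : ∀ w ∉ K, θ w • c = 0 := fun w hw => by rw [hθ0 w hw, zero_smul]
  obtain ⟨C, hC⟩ := hθ.bounded_above_of_compact_support hθc
  -- Cauchy–Schwarz in `ℝ≥0∞`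
  have hCS : ∀ d : E, ‖⟪d, c⟫‖ₑ ≤ ‖d‖ₑ * ‖c‖ₑ := fun d => by
    rw [← ofReal_norm, ← ofReal_norm, ← ofReal_norm, ← ENNReal.ofReal_mul (norm_nonneg _)]
    exact ENNReal.ofReal_le_ofReal (norm_inner_le_norm d c)
  -- integrability of the pairings
  have hint : ∀ g : ℝ → E → E, LocallyIntegrableOn (uncurry g) (Ω : Set (ℝ × E)) volume →
      Integrable (fun w : ℝ × E => θ w * ⟪g w.1 w.2, c⟫) volume := by
    intro g hg
    have h := integrable_inner_of_locallyIntegrableOn hg (w := fun z : ℝ × E => θ z • c)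
      (hθ.smul continuous_const) hK hθΩ hθc0
    exact h.congr (ae_of_all _ fun w => by simp only [real_inner_smul_right])
  -- the error bound `B_k = C |c| vol(K)^{2/3} ‖v_k - u‖_{L³(Q₀)} → 0`
  have hKfin : volume K ≠ ∞ := hK.measure_lt_top.ne
  set B : ℕ → ℝ≥0∞ := fun k => ENNReal.ofReal C * ‖c‖ₑ *
    (volume K ^ (1 / (1 : ℝ≥0∞).toReal - 1 / (3 : ℝ≥0∞).toReal) *
      eLpNorm (uncurry (v k) - uncurry u) 3 (volume.restrict Q₀)) with hB
  have hCc : ENNReal.ofReal C * ‖c‖ₑ ≠ ∞ := ENNReal.mul_ne_top ENNReal.ofReal_ne_top enorm_ne_top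
  have hBlim : Tendsto B atTop (𝓝 0) := by
    have ha : ENNReal.ofReal C * ‖c‖ₑ *
        volume K ^ (1 / (1 : ℝ≥0∞).toReal - 1 / (3 : ℝ≥0∞).toReal) ≠ ∞ :=
      ENNReal.mul_ne_top hCc (ENNReal.rpow_ne_top_of_nonneg (by norm_num) hKfin)
    have h := ENNReal.Tendsto.const_mul hconv (Or.inr ha)
    rw [mul_zero] at h
    simpa only [hB, mul_assoc] using h
  -- the estimate `‖∫ θ ⟪v_k, c⟫ - ∫ θ ⟪u, c⟫‖ₑ ≤ B_k`
  have hest : ∀ k, ‖(∫ w, θ w * ⟪v k w.1 w.2, c⟫) - ∫ w, θ w * ⟪u w.1 w.2, c⟫‖ₑ ≤ B k := by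
    intro k
    rw [← integral_sub (hint _ (hv k)) (hint _ hu)]
    refine (enorm_integral_le_lintegral_enorm _).trans ?_
    have hpt : ∀ w : ℝ × E, ‖θ w * ⟪v k w.1 w.2, c⟫ - θ w * ⟪u w.1 w.2, c⟫‖ₑ ≤
        K.indicator (fun w => ENNReal.ofReal C * ‖c‖ₑ * ‖(uncurry (v k) - uncurry u) w‖ₑ) w := by
      intro w
      by_cases hw : w ∈ K
      · rw [indicator_of_mem hw, ← mul_sub, ← inner_sub_left, enorm_mul]
        calc ‖θ w‖ₑ * ‖⟪v k w.1 w.2 - u w.1 w.2, c⟫‖ₑ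
            ≤ ENNReal.ofReal C * (‖v k w.1 w.2 - u w.1 w.2‖ₑ * ‖c‖ₑ) := by
              gcongr
              · rw [← ofReal_norm]; exact ENNReal.ofReal_le_ofReal (hC w)
              · exact hCS _
          _ = ENNReal.ofReal C * ‖c‖ₑ * ‖(uncurry (v k) - uncurry u) w‖ₑ := by
              rw [mul_comm (‖v k w.1 w.2 - u w.1 w.2‖ₑ) (‖c‖ₑ), mul_assoc]; rfl
      · rw [indicator_of_notMem hw, hθ0 w hw, zero_mul, zero_mul, sub_zero, enorm_zero]
    refine (lintegral_mono hpt).trans ?_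
    rw [lintegral_indicator hKm, lintegral_const_mul' _ _ hCc, ← eLpNorm_one_eq_lintegral_enorm]
    have hmeas : AEStronglyMeasurable (uncurry (v k) - uncurry u) (volume.restrict K) :=
      ((hv k).aestronglyMeasurable.sub hu.aestronglyMeasurable).mono_measure
        (Measure.restrict_mono hθΩ le_rfl)
    have h1 := eLpNorm_le_eLpNorm_mul_rpow_measure_univ (p := 1) (q := 3) (by norm_num) hmeas
    rw [Measure.restrict_apply_univ] at h1
    have h2 : eLpNorm (uncurry (v k) - uncurry u) 3 (volume.restrict K) ≤
        eLpNorm (uncurry (v k) - uncurry u) 3 (volume.restrict Q₀) :=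
      eLpNorm_mono_measure _ (Measure.restrict_mono (hθΩ.trans hΩ) le_rfl)
    calc ENNReal.ofReal C * ‖c‖ₑ * eLpNorm (uncurry (v k) - uncurry u) 1 (volume.restrict K)
        ≤ ENNReal.ofReal C * ‖c‖ₑ * (eLpNorm (uncurry (v k) - uncurry u) 3 (volume.restrict Q₀) *
            volume K ^ (1 / (1 : ℝ≥0∞).toReal - 1 / (3 : ℝ≥0∞).toReal)) := by
          gcongr
          exact h1.trans (mul_le_mul' h2 le_rfl)
      _ = B k := by rw [hB]; ring
  -- conclude
  rw [tendsto_iff_edist_tendsto_0]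
  refine tendsto_of_tendsto_of_tendsto_of_le_of_le tendsto_const_nhds hBlim (fun k => bot_le)
    fun k => ?_
  rw [edist_eq_enorm_sub]
  exact hest k

end Limit

end Literature.Analysis.FluidPDE
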